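import Mathlib

/-!
# Crux `MonotoneSuffices` (stmt-PneNP-18026), line `slice-transport` — stub `stub_transport`, part 5:
# slices with a protected set, and the fibres of planting

Generic counting on the cube `α → Bool` (`supp x = {a | x a}`):

* `card_slice_supset` — the vectors `y` with `#supp y = j` and `K ⊆ supp y` number `C(N - #K, j - #K)`
  (`#K ≤ j`, `N = |α|`; bijection `y ↦ supp y \ K`); `slice_supset_eq_empty` below `#K`;
* `sum_plant_eq` — **planting is `2^{#K}`-to-one onto its image**: for every `g`,
  `∑_x g (x ⊔ K) = 2^{#K} · ∑_{y : K ⊆ supp y} g y`, where `(x ⊔ K) a = x a ∨ [a ∈ K]` (the planted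
  clique map `plant A` of `PlantedClique.lean` is `· ⊔ K_A`).
-/

set_option linter.dupNamespace false -- `Summit.PneNP.PneNP.…`: summit = sub-problem name (D-0017 single-conjunct layout)

namespace Summit.PneNP.PneNP.Theorems.MonotoneSuffices.SliceTransport

open Finset

variable {α : Type*} [Fintype α] [DecidableEq α]

/-! ### Slices with a protected set -/

/-- **Vectors of weight `j` containing `K` number `C(N - #K, j - #K)`** (`#K ≤ j`). [folklore] -/
theorem card_slice_supset (K : Finset α) {j : ℕ} (hj : #K ≤ j) :
    #((univ : Finset (α → Bool)).filter fun y =>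
        #(univ.filter fun a => y a = true) = j ∧ K ⊆ univ.filter fun a => y a = true) =
      (Fintype.card α - #K).choose (j - #K) := by
  classical
  rw [← card_univ, ← card_sdiff_of_subset (subset_univ K), ← card_powersetCard]
  refine card_bij' (fun y _ => (univ.filter fun a => y a = true) \ K)
    (fun T _ => fun a => decide (a ∈ T ∪ K)) ?_ ?_ ?_ ?_
  · intro y hy
    rw [mem_filter] at hy
    obtain ⟨-, hyj, hKy⟩ := hy
    rw [mem_powersetCard]
    exact ⟨sdiff_subset_sdiff (subset_univ _) Subset.rfl, by rw [card_sdiff_of_subset hKy, hyj]⟩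
  · intro T hT
    rw [mem_powersetCard] at hT
    obtain ⟨hTsub, hTcard⟩ := hT
    have hdisj : Disjoint T K := by
      rw [disjoint_left]
      intro a ha haK
      exact (mem_sdiff.1 (hTsub ha)).2 haK
    have hsupp : (univ.filter fun a => decide (a ∈ T ∪ K) = true) = T ∪ K := by
      ext a; simp
    rw [mem_filter, hsupp]
    refine ⟨mem_univ _, ?_, subset_union_right⟩
    rw [card_union_of_disjoint hdisj, hTcard]
    omega
  · intro y hy
    rw [mem_filter] at hy
    obtain ⟨-, -, hKy⟩ := hy
    funext a
    by_cases hya : y a = true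
    · have : a ∈ (univ.filter fun a => y a = true) \ K ∪ K := by
        by_cases haK : a ∈ K
        · exact mem_union_right _ haK
        · exact mem_union_left _ (mem_sdiff.2 ⟨mem_filter.2 ⟨mem_univ _, hya⟩, haK⟩)
      rw [hya]
      exact decide_eq_true this
    · have hya' : y a = false := by simpa using hya
      rw [hya']
      apply decide_eq_false
      intro h
      rcases mem_union.1 h with h | h
      · exact hya (mem_filter.1 (mem_sdiff.1 h).1).2
      · exact hya (mem_filter.1 (hKy h)).2
  · intro T hT
    rw [mem_powersetCard] at hT
    obtain ⟨hTsub, -⟩ := hT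
    have hsupp : (univ.filter fun a => decide (a ∈ T ∪ K) = true) = T ∪ K := by
      ext a; simp
    rw [hsupp, union_sdiff_right]
    ext a
    rw [mem_sdiff]
    exact ⟨fun h => h.1, fun h => ⟨h, fun haK => (mem_sdiff.1 (hTsub h)).2 haK⟩⟩

/-- Below weight `#K` no vector contains `K`. [folklore] -/
theorem slice_supset_eq_empty (K : Finset α) {j : ℕ} (hj : j < #K) :
    ((univ : Finset (α → Bool)).filter fun y =>
        #(univ.filter fun a => y a = true) = j ∧ K ⊆ univ.filter fun a => y a = true) = ∅ := by
  rw [filter_eq_empty_iff]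
  rintro y - ⟨hyj, hKy⟩
  have := card_le_card hKy
  omega

/-- The plain slice: `#{y | #supp y = j} = C(N, j)`. [folklore] -/
theorem card_slice_eq_choose (j : ℕ) :
    #((univ : Finset (α → Bool)).filter fun y => #(univ.filter fun a => y a = true) = j) =
      (Fintype.card α).choose j := by
  have h := card_slice_supset (α := α) (∅ : Finset α) (j := j) (by simp)
  simp only [card_empty, Nat.sub_zero, empty_subset, and_true] at h
  exact h

/-! ### The fibres of planting -/

/-- Planting `K` lands on the vectors containing `K`. [folklore] -/
theorem subset_filter_plant (x : α → Bool) (K : Finset α) :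
    K ⊆ univ.filter fun a => (x a || decide (a ∈ K)) = true := by
  intro a ha
  simp [ha]

/-- **The fibre of planting over a vector containing `K` has `2^{#K}` elements.** [folklore] -/
theorem card_filter_plant_eq {y : α → Bool} {K : Finset α} (hKy : K ⊆ univ.filter fun a => y a = true) :
    #((univ : Finset (α → Bool)).filter fun x => (fun a => x a || decide (a ∈ K)) = y) = 2 ^ #K := by
  classical
  rw [← card_powerset]
  refine card_bij' (fun x _ => K.filter fun a => x a = true)
    (fun T _ => fun a => if a ∈ K then decide (a ∈ T) else y a) ?_ ?_ ?_ ?_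
  · intro x _
    exact mem_powerset.2 (filter_subset _ _)
  · intro T hT
    rw [mem_filter]
    refine ⟨mem_univ _, ?_⟩
    funext a
    by_cases haK : a ∈ K
    · have hya : y a = true := (mem_filter.1 (hKy haK)).2
      simp [haK, hya]
    · simp [haK]
  · intro x hx
    rw [mem_filter] at hx
    obtain ⟨-, hxy⟩ := hx
    funext a
    by_cases haK : a ∈ K
    · simp only [haK, ↓reduceIte, mem_filter, true_and]
      cases x a <;> simp
    · have := congrFun hxy a
      simp only [haK, decide_false, Bool.or_false] at this
      simp [haK, this]
  · intro T hT
    rw [mem_powerset] at hT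
    ext a
    simp only [mem_filter]
    constructor
    · rintro ⟨haK, h⟩
      simpa [haK] using h
    · intro haT
      exact ⟨hT haT, by simp [hT haT, haT]⟩

/-- **Planting is `2^{#K}`-to-one**: `∑_x g (x ⊔ K) = 2^{#K} · ∑_{y : K ⊆ supp y} g y`. [folklore] -/
theorem sum_plant_eq (K : Finset α) (g : (α → Bool) → ℝ) :
    ∑ x : α → Bool, g (fun a => x a || decide (a ∈ K)) =
      (2 : ℝ) ^ #K * ∑ y ∈ (univ : Finset (α → Bool)).filter
        (fun y => K ⊆ univ.filter fun a => y a = true), g y := by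
  classical
  set Y := (univ : Finset (α → Bool)).filter (fun y => K ⊆ univ.filter fun a => y a = true) with hY
  have hmaps : ∀ x ∈ (univ : Finset (α → Bool)), (fun a => x a || decide (a ∈ K)) ∈ Y := fun x _ => by
    rw [hY, mem_filter]
    exact ⟨mem_univ _, subset_filter_plant x K⟩
  rw [← sum_fiberwise_of_maps_to hmaps, mul_sum]
  refine sum_congr rfl fun y hy => ?_
  have hKy : K ⊆ univ.filter fun a => y a = true := (mem_filter.1 hy).2
  have : ∑ x ∈ (univ : Finset (α → Bool)).filter (fun x => (fun a => x a || decide (a ∈ K)) = y),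
      g (fun a => x a || decide (a ∈ K)) =
      ∑ x ∈ (univ : Finset (α → Bool)).filter (fun x => (fun a => x a || decide (a ∈ K)) = y), g y :=
    sum_congr rfl fun x hx => by rw [(mem_filter.1 hx).2]
  rw [this, sum_const, nsmul_eq_mul, card_filter_plant_eq hKy]
  push_cast
  ring

/-- **transport_planting** (registered helper sub-goal of stmt-PneNP-18026 for `stub_transport`,
part 5): planting a fixed set is `2^{#K}`-to-one onto the vectors containing it (`sum_plant_eq`).
[folklore] -/
theorem transport_planting :
    ∀ {α : Type*} [Fintype α] [DecidableEq α] (K : Finset α) (g : (α → Bool) → ℝ), ∑ x : α → Bool, g (fun a => x a || decide (a ∈ K)) = (2 : ℝ) ^ #K * ∑ y ∈ (Finset.univ : Finset (α → Bool)).filter (fun y => K ⊆ Finset.univ.filter fun a => y a = true), g y :=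
  fun K g => sum_plant_eq K g

end Summit.PneNP.PneNP.Theorems.MonotoneSuffices.SliceTransport
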